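import Summits.BirchSwinnertonDyer.BirchSwinnertonDyer.Theses.TameQuarticManinParity
import Literature.NumberTheory.EllipticCurves.ModularSymbolsEichlerShimuraHoldsProofs
import HarnessLib

/-!
# Route `TameQuarticManinParity`, LINE 36 (bsd-idea-3 g11), glue G36 `KnappKernelOfModPrimeBound`
# (stmt-BirchSwinnertonDyer-23969) — PROVED

`ModPrimeEllipticParabolicCocycleBound → periodFunctional_ker_le_ellipticParabolic_sup_commutator`:
Knapp's integral period presentation (Prop. 11.22: the kernel of `γ ↦ {∞, γ∞}` on `Γ₀(N)` is
`Γ_ep · [Γ₀(N), Γ₀(N)]`) from the mod-`ℓ` elliptic–parabolic cocycle bound (M36), by commutative algebra: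
`Q = Γ₀(N)ᵃᵇ/⟨Γ_ep⟩` is a finitely generated abelian group mapping onto the period lattice `Λ ≅ ℤ^{2g}`
(`periodHomology_eq_span_basis_of_genus`, `coe_periodHomology_eq_range`); the kernel `K₀` of `Q → Λ` is a
direct summand, hence finitely generated; if `K₀ ≠ 0` it has a non-zero additive map to some `𝔽_ℓ`
(structure theorem), which together with the `2g` coordinate maps gives `2g + 1` independent additive
elliptic–parabolic-killing maps `Γ₀(N) → 𝔽_ℓ`, contradicting M36.  BSD is NOT proved by this; no summit is
proved; M36 stays OPEN here.  Theorems only; no `sorry`; axioms `propext`, `Classical.choice`, `Quot.sound`.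
Provenance: written by the route planner bsd-idea-3 g11 (HOME ideas/l37/G36_proof.lean, 2026-08-29T02:20Z), landed
verbatim by the landing seat bsd-line-ttd-p1 g13 (the two finite-generation helpers inlined: the tree already has
`fg_gamma0` / `groupFG_SL2Z`).  Note: the conclusion K is meanwhile ALSO a tree theorem on its own
(`Literature.NumberTheory.ModularSymbols.periodFunctional_ker_le_ellipticParabolic_sup_commutator_holds`); this file is
the honest proof of the implication the item states.
-/

set_option autoImplicit false
set_option linter.dupNamespace false

noncomputable section

open scoped MatrixGroups ModularForm

open CongruenceSubgroup
open Literature.NumberTheory.EllipticCurves.ModularForms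
open Literature.NumberTheory.ModularSymbols

namespace Summit.BirchSwinnertonDyer.BirchSwinnertonDyer.Theorems.TameQuarticManinParity

open Summit.BirchSwinnertonDyer.BirchSwinnertonDyer.Theses.TameQuarticManinParity

/-! ### Algebra: a non-trivial finitely generated abelian group has a non-zero map to some `𝔽_ℓ` -/

/-- A non-trivial finitely generated abelian group admits a non-zero additive map to `ZMod ℓ` for some
prime `ℓ` (structure theorem `AddCommGroup.equiv_free_prod_directSum_zmod`). [folklore] -/
theorem exists_addMonoidHom_zmod_ne_zero (K : Type*) [AddCommGroup K] [AddGroup.FG K] [Nontrivial K] :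
    ∃ ℓ : ℕ, ℓ.Prime ∧ ∃ χ : K →+ ZMod ℓ, χ ≠ 0 := by
  classical
  obtain ⟨n, ι, _, p, hp, e, ⟨φ⟩⟩ := AddCommGroup.equiv_free_prod_directSum_zmod K
  by_cases hn : n ≠ 0
  · refine ⟨2, Nat.prime_two, ?_⟩
    let i₀ : Fin n := ⟨0, Nat.pos_of_ne_zero hn⟩
    let c : K →+ ℤ :=
      (Finsupp.applyAddHom i₀).comp ((AddMonoidHom.fst _ _).comp φ.toAddMonoidHom)
    refine ⟨(Int.castAddHom (ZMod 2)).comp c, fun h ↦ ?_⟩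
    have h1 := DFunLike.congr_fun h (φ.symm (Finsupp.single i₀ 1, 0))
    simp [c] at h1
  · push Not at hn
    subst hn
    by_cases he : ∃ i, e i ≠ 0
    · obtain ⟨i, hi⟩ := he
      haveI : Fact (p i).Prime := ⟨hp i⟩
      refine ⟨p i, hp i, ?_⟩
      let c : K →+ ZMod (p i ^ e i) :=
        (DirectSum.component ℤ ι (fun j ↦ ZMod (p j ^ e j)) i).toAddMonoidHom.comp
          ((AddMonoidHom.snd _ _).comp φ.toAddMonoidHom)
      refine ⟨(ZMod.castHom (dvd_pow_self (p i) hi) (ZMod (p i))).toAddMonoidHom.comp c, fun h ↦ ?_⟩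
      have h1 := DFunLike.congr_fun h
        (φ.symm (0, DirectSum.lof ℤ ι (fun j ↦ ZMod (p j ^ e j)) i 1))
      simp [c] at h1
      rw [ZMod.cast_one (dvd_pow_self (p i) hi)] at h1
      exact one_ne_zero h1
    · push Not at he
      exfalso
      obtain ⟨k, hk⟩ := exists_ne (0 : K)
      apply hk
      apply φ.injective
      rw [map_zero]
      refine Prod.ext (Finsupp.ext fun a ↦ Fin.elim0 a) ?_
      refine DFinsupp.ext fun j ↦ ?_
      haveI : Subsingleton (ZMod (p j ^ e j)) := by
        rw [he j, pow_zero]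
        exact ZMod.subsingleton_iff.mpr rfl
      exact Subsingleton.elim _ _

/-! ### The glue G36 -/

/-- **G36** (stmt-BirchSwinnertonDyer-23969): the mod-`ℓ` elliptic–parabolic cocycle bound implies Knapp's
integral period presentation `ker(γ ↦ {∞, γ∞}) ≤ Γ_ep ⊔ [Γ₀(N), Γ₀(N)]`. [cite: Knapp1993, Prop. 11.22] -/
theorem knappKernelOfModPrimeBound_proof : KnappKernelOfModPrimeBound := by
  intro hM N _ γ₀ hγ₀
  by_contra hnot
  classical
  -- the abelian group `Q = Γ₀(N)ᵃᵇ / ⟨Γ_ep⟩` and the additive projection `π : Γ₀(N) → Q`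
  let E : Subgroup (Gamma0 N) := ellipticParabolicSubgroup N
  let D := Module.Dual ℂ (CuspForm (Gamma0 N) 2)
  let A := Additive (Abelianization (Gamma0 N))
  let MA : AddSubgroup A := Subgroup.toAddSubgroup (E.map Abelianization.of)
  let Q := A ⧸ MA
  have hMA : ∀ x : A, x ∈ MA ↔ ∃ e ∈ E, Abelianization.of e = Additive.toMul x := fun x ↦ by
    show Additive.toMul x ∈ E.map Abelianization.of ↔ _
    exact Subgroup.mem_map
  let π : Gamma0 N → Q := fun γ ↦ QuotientAddGroup.mk' MA (Additive.ofMul (Abelianization.of γ))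
  have hπ_mul : ∀ γ δ, π (γ * δ) = π γ + π δ := by
    intro γ δ
    simp only [π, map_mul, ofMul_mul, map_add]
  have hπ_E : ∀ γ ∈ E, π γ = 0 := by
    intro γ hγ
    show ((Additive.ofMul (Abelianization.of γ) : A) : Q) = 0
    exact (QuotientAddGroup.eq_zero_iff _).mpr ((hMA _).mpr ⟨γ, hγ, by rw [toMul_ofMul]⟩)
  have hπ_ne : π γ₀ ≠ 0 := by
    intro h0
    obtain ⟨e, he, hee⟩ := (hMA _).mp ((QuotientAddGroup.eq_zero_iff _).mp h0)
    rw [toMul_ofMul] at hee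
    apply hnot
    have hc : e⁻¹ * γ₀ ∈ commutator (Gamma0 N) := by
      rw [← Abelianization.ker_of, MonoidHom.mem_ker, map_mul, map_inv, hee, inv_mul_cancel]
    have : γ₀ = e * (e⁻¹ * γ₀) := by group
    rw [this]
    exact Subgroup.mul_mem_sup he hc
  have hπ_surj : Function.Surjective π := by
    intro q
    obtain ⟨a, rfl⟩ := QuotientAddGroup.mk'_surjective MA q
    obtain ⟨γ, hγ⟩ := QuotientGroup.mk_surjective (Additive.toMul a)
    exact ⟨γ, by simp only [π]; rw [show Abelianization.of γ = Additive.toMul a from hγ, ofMul_toMul]⟩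
  -- the period map on `Q`
  let PA : A →+ D := MonoidHom.toAdditiveLeft (Abelianization.lift (periodFunctionalHom N))
  have hPA_apply : ∀ γ : Gamma0 N, PA (Additive.ofMul (Abelianization.of γ)) = periodFunctional N γ := by
    intro γ
    rfl
  have hPA : MA ≤ PA.ker := by
    intro x hx
    obtain ⟨e, he, hex⟩ := (hMA x).mp hx
    rw [AddMonoidHom.mem_ker, ← ofMul_toMul x, ← hex, hPA_apply]
    exact periodFunctional_eq_zero_of_mem_ellipticParabolicSubgroup N he
  let Pbar : Q →+ D := QuotientAddGroup.lift MA PA hPA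
  have hPbar : ∀ γ, Pbar (π γ) = periodFunctional N γ := by
    intro γ
    simp only [Pbar, π, QuotientAddGroup.mk'_apply]
    rw [QuotientAddGroup.lift_mk', hPA_apply]
  -- the period lattice `Λ = span_ℤ b`, `b` a real basis of `D` with `2g` members
  obtain ⟨n, b, hΛ⟩ :=
    periodHomology_eq_span_basis_of_genus N (twelve_mul_finrank_cuspForm_two_gamma0_holds N)
  have hn : n = 2 * Module.finrank ℂ (CuspForm (Gamma0 N) 2) := by
    have h := Module.finrank_eq_card_basis b
    rw [Fintype.card_fin, finrank_real_of_complex, Subspace.dual_finrank_eq] at h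
    omega
  have hbZ : LinearIndependent ℤ b := by
    refine b.linearIndependent.restrict_scalars ?_
    intro r s h
    simpa using h
  let bZ := Module.Basis.span hbZ
  have hPmem : ∀ γ : Gamma0 N, periodFunctional N γ ∈ Submodule.span ℤ (Set.range b) := by
    intro γ
    have h : periodFunctional N γ ∈ (periodHomology N : Set D) := AddSubgroup.subset_closure ⟨γ, rfl⟩
    rw [hΛ] at h
    exact h
  have hPbar_mem : ∀ q, Pbar q ∈ Submodule.span ℤ (Set.range b) := by
    intro q
    obtain ⟨γ, rfl⟩ := hπ_surj q
    rw [hPbar]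
    exact hPmem γ
  let Pres : Q →+ Submodule.span ℤ (Set.range b) :=
    AddMonoidHom.codRestrict Pbar (Submodule.span ℤ (Set.range b)) hPbar_mem
  let coord : Fin n → Q →+ ℤ := fun i ↦
    (Finsupp.applyAddHom i).comp (bZ.repr.toLinearMap.toAddMonoidHom.comp Pres)
  -- generators `γ_j` with `{∞, γ_j ∞} = b_j`
  have hbj : ∀ j, ∃ γ : Gamma0 N, periodFunctional N γ = b j := by
    intro j
    have h : (b j : D) ∈ (periodHomology N : Set D) := by
      rw [hΛ]
      exact Submodule.subset_span ⟨j, rfl⟩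
    rw [coe_periodHomology_eq_range] at h
    exact h
  choose γb hγb using hbj
  have hPres_b : ∀ j, Pres (π (γb j)) = bZ j := by
    intro j
    apply Subtype.ext
    rw [Module.Basis.span_apply]
    show Pbar (π (γb j)) = b j
    rw [hPbar, hγb]
  have hcoord_b : ∀ i j, coord i (π (γb j)) = if j = i then 1 else 0 := by
    intro i j
    simp only [coord, AddMonoidHom.coe_comp, Function.comp_apply, LinearMap.toAddMonoidHom_coe,
      LinearEquiv.coe_coe, hPres_b, Module.Basis.repr_self, Finsupp.applyAddHom_apply,
      Finsupp.single_apply]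
  have hPres_0 : Pres (π γ₀) = 0 := by
    apply Subtype.ext
    show Pbar (π γ₀) = 0
    rw [hPbar, hγ₀]
  have hcoord_0 : ∀ i, coord i (π γ₀) = 0 := by
    intro i
    simp only [coord, AddMonoidHom.coe_comp, Function.comp_apply, LinearMap.toAddMonoidHom_coe,
      LinearEquiv.coe_coe, hPres_0, map_zero]
  -- the projection `κ` onto the kernel `K₀` of `Q → Λ`
  let κ : Q →+ Q := AddMonoidHom.mk' (fun q ↦ q - ∑ i, coord i q • π (γb i)) (by
    intro x y
    simp only [map_add, add_zsmul, Finset.sum_add_distrib]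
    abel)
  have hκ_b : ∀ j, κ (π (γb j)) = 0 := by
    intro j
    simp only [κ, AddMonoidHom.mk'_apply, hcoord_b, ite_smul, one_zsmul, zero_zsmul,
      Finset.sum_ite_eq, Finset.mem_univ, if_true, sub_self]
  have hκ_0 : κ (π γ₀) = π γ₀ := by
    simp only [κ, AddMonoidHom.mk'_apply, hcoord_0, zero_zsmul, Finset.sum_const_zero, sub_zero]
  -- `K₀ = range κ` is finitely generated and non-trivial
  haveI : Group.FG (Abelianization (Gamma0 N)) := by
    haveI : Group.FG (Gamma0 N) := by
      haveI : Group.FG SL(2, ℤ) :=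
        Group.fg_iff.mpr ⟨{ModularGroup.S, ModularGroup.T}, _root_.SpecialLinearGroup.SL2Z_generators,
          Set.toFinite _⟩
      exact Subgroup.fg_of_index_ne_zero (Gamma0 N)
    show Group.FG (Gamma0 N ⧸ commutator (Gamma0 N))
    infer_instance
  haveI : AddGroup.FG A := inferInstance
  haveI : AddGroup.FG Q := QuotientAddGroup.fg MA
  haveI : AddGroup.FG κ.range := AddGroup.fg_range κ
  haveI : Nontrivial κ.range :=
    ⟨⟨⟨κ (π γ₀), ⟨π γ₀, rfl⟩⟩, 0, fun h ↦ hπ_ne (by rw [← hκ_0]; exact congrArg Subtype.val h)⟩⟩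
  obtain ⟨ℓ, hℓ, χ, hχ⟩ := exists_addMonoidHom_zmod_ne_zero κ.range
  haveI : Fact ℓ.Prime := ⟨hℓ⟩
  -- the `2g + 1` maps `Γ₀(N) → 𝔽_ℓ`
  let u : Option (Fin n) → Gamma0 N → ZMod ℓ := fun o ↦
    match o with
    | none => fun γ ↦ χ (κ.rangeRestrict (π γ))
    | some i => fun γ ↦ ((coord i (π γ) : ℤ) : ZMod ℓ)
  have hu_none : ∀ γ, u none γ = χ (κ.rangeRestrict (π γ)) := fun _ ↦ rfl
  have hu_some : ∀ i γ, u (some i) γ = ((coord i (π γ) : ℤ) : ZMod ℓ) := fun _ _ ↦ rfl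
  have hadd : ∀ o (γ δ : Gamma0 N), u o (γ * δ) = u o γ + u o δ := by
    rintro (_ | i) γ δ
    · simp only [hu_none, hπ_mul, map_add]
    · simp only [hu_some, hπ_mul, map_add, Int.cast_add]
  have hkill : ∀ o (γ : Gamma0 N), (((γ : SL(2, ℤ)) : Matrix (Fin 2) (Fin 2) ℤ).IsParabolic ∨
      ((γ : SL(2, ℤ)) : Matrix (Fin 2) (Fin 2) ℤ).IsElliptic) → u o γ = 0 := by
    intro o γ hγ
    have hE : γ ∈ E := hγ.elim mem_ellipticParabolicSubgroup_of_isParabolic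
      mem_ellipticParabolicSubgroup_of_isElliptic
    rcases o with _ | i
    · simp only [hu_none, hπ_E γ hE, map_zero]
    · simp only [hu_some, hπ_E γ hE, map_zero, Int.cast_zero]
  have hli : LinearIndependent (ZMod ℓ) u := by
    rw [Fintype.linearIndependent_iff]
    intro g hg
    have hg' : ∀ γ, g none • u none γ + ∑ i, g (some i) • u (some i) γ = 0 := by
      intro γ
      have h := congrFun hg γ
      simp only [Finset.sum_apply, Pi.smul_apply, Pi.zero_apply, Fintype.sum_option] at h
      exact h
    have hsome : ∀ j, g (some j) = 0 := by
      intro j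
      have h := hg' (γb j)
      have h0 : u none (γb j) = 0 := by
        rw [hu_none]
        have : κ.rangeRestrict (π (γb j)) = 0 := Subtype.ext (by
          rw [AddMonoidHom.coe_rangeRestrict]; exact hκ_b j)
        rw [this, map_zero]
      simp only [h0, zero_add, hu_some, hcoord_b, Int.cast_ite, Int.cast_one,
        Int.cast_zero, smul_eq_mul, mul_ite, mul_one, mul_zero, Finset.sum_ite_eq,
        Finset.mem_univ, if_true] at h
      exact h
    have hnone : g none = 0 := by
      obtain ⟨k, hk⟩ : ∃ k : κ.range, χ k ≠ 0 := by
        by_contra hall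
        push Not at hall
        exact hχ (AddMonoidHom.ext hall)
      obtain ⟨q, rfl⟩ := AddMonoidHom.rangeRestrict_surjective κ k
      obtain ⟨γ, rfl⟩ := hπ_surj q
      have h := hg' γ
      simp only [hsome, Finset.sum_const_zero, add_zero, hu_none, smul_eq_mul, zero_mul] at h
      exact (mul_eq_zero.mp h).resolve_right hk
    rintro (_ | j)
    · exact hnone
    · exact hsome j
  have hcard := hM N ℓ (Option (Fin n)) u hadd hkill hli
  rw [Fintype.card_option, Fintype.card_fin] at hcard
  omega

end Summit.BirchSwinnertonDyer.BirchSwinnertonDyer.Theorems.TameQuarticManinParity
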